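import Summits.Ventures.GridStability.Models.WSCC9FaultOnTube
import Summits.Ventures.GridStability.Bench.WSCC9Deg4ASosgramDinstRoaModel
import Summits.Ventures.GridStability.Models.RecastAngles

/-!
# Bench/WSCC9CctLowerGlue — GLUE of the row «G1cct-WSCC9-LOWER-K» (point form): clearing the bus-7 fault AT t_cl = 1/12 s returns every motion of MODEL M′ to synchronism (kernel-only, modulo the named «K ⊂ S» fact)

Venture GRIDFUSION (LADDER-GRIDFUSION G1-cct; lead g4 2026-08-27T07:24:26Z (3) / 07:35:02Z (i)), seat
gridfusion-model-1.  COMPOSITION, no new estimate: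
(1) the kernel fault-on tube `WSCC9.faultBus7_tube` (p510936): at `T = 1/12` the cleared state lies in the box
`K(1/12)` — relative angles `a2 ∈ a2⁰ + [(lo₂ − hi₁), (hi₂ − lo₁)]/288`, `a3 ∈ a3⁰ + [(lo₃ − hi₁), (hi₃ − lo₁)]/288`,
printed speeds `ω_i ∈ [lo_i, hi_i]/12`, hence v-frame speeds `v_i = ω_i − ω∞′`;
(2) the «K ⊂ S» kernel inequality (sos-3, TAKEN 07:40:38Z; here the HYPOTHESIS `hKS`, stated on the exact
rational box `K(1/12)` of (1)): `V_deg4(recast x) ≤ 1159/1000` for every state `x` in `K(1/12)`;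
(3) sos-3's deg-4 D-instance ROA `WSCC9.deg4_A_sosgram_Dinst_model_roa` (p509956) at `γ = c = 1159/1000`.
FRAMES: the fault-on leg runs in the printed frame (`faultBus7Printed`, `ω(0) = 0`); the post-fault model of
record `WSCC9.postB_SPdamp.toModel` is in the frame `v = ω − ω∞′` (MV-ω), so the clearing state handed over is
`c 0 = (δ(1/12), ω(1/12) − ω∞′·1)` (hypothesis `hc0`; angles are frame-independent).
THREE COLUMNS: CERTIFIED (modulo `hKS`, a kernel fact being typed) = the sentence below about MODEL M′
(classical WSCC9, MV-2 + MV-P + MV-SPD + MV-ω + MV-h12; fault at bus 7 cleared by opening line 5–7 AT 5 cycles);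
VALIDATED (G1-LOG, RK4: every t_cl ≤ 0.09 s returns, first exit 0.123 s) and PUBLISHED (Anderson–Fouad's
simulated-stable 5-cycle case) are printed beside it, never merged.  Honest framing (RULING 27 (B)): a kernel
lower bound for M′, never «the CCT».  [cite: AndersonFouad1977, Example 2.6 / §2.10; Moore1979, §8.1]
-/

noncomputable section

open Real Set Filter Topology

namespace Summit.Ventures.GridStability.Bench

open Summit.Ventures.GridStability.Models Summit.Ventures.GridStability.Models.WSCC9

/-- **«G1cct-WSCC9-LOWER-K» (point form), modulo the named «K ⊂ S» fact.**  For every fault-on solution `Y`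
of `faultBus7Printed` on `[0, 1/12]` from the printed pre-fault point at synchronous speed, and every
post-fault solution `c` of `WSCC9.postB_SPdamp.toModel` on `[0, ∞)` starting from the cleared state
(`c 0 = (δ(1/12), ω(1/12) − ω∞′)`): NO relative angle ever reaches `±π` (no pole slip), every relative-angle
deviation `u_i(t) → 0` and every speed deviation `→ 0` — PROVIDED the kernel inequality `hKS`
(«`V_deg4 ∘ recast ≤ 1159/1000` on the tube box `K(1/12)`», sos-3's file) holds.
[cite: AndersonFouad1977, Example 2.6; Moore1979, §8.1 eq. (8.10)] -/
theorem wscc9_clearing_5cycles_returns_of_KS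
    (hKS : ∀ x : ClassicalSwing.State 3,
      x.1 1 - x.1 0 ∈ Icc (7617 / 25000 + (11797 / 250 - 223 / 250) / 288 : ℝ)
        (15239 / 50000 + (48009 / 1000 - 131 / 500) / 288) →
      x.1 2 - x.1 0 ∈ Icc (761 / 4000 + (5997 / 250 - 223 / 250) / 288 : ℝ)
        (3807 / 20000 + (29611 / 1000 - 131 / 500) / 288) →
      (∀ j : Fin 3, x.2 j + (omegaInf : ℝ) ∈ Icc (tubeLo j / 12) (tubeHi j / 12)) →
      WSCC9.deg4_A_sosgram_Dinst_Vz (WSCC9.deg2_A_SPdampH12_Z postB_SPdamp.angleOf x) ≤ 1159 / 1000)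
    {Y : ℝ → ClassicalSwing.State 3} (hY : faultBus7Printed.IsSolutionOn Y (Icc 0 (1 / 12)))
    (hω0 : (Y 0).2 = 0) (ha2 : (Y 0).1 1 - (Y 0).1 0 ∈ a2Window) (ha3 : (Y 0).1 2 - (Y 0).1 0 ∈ a3Window)
    {c : ℝ → ClassicalSwing.State 3} (hc : postB_SPdamp.toModel.IsSolutionOn c (Ici 0))
    (hc0 : c 0 = ((Y (1 / 12)).1, fun j => (Y (1 / 12)).2 j - (omegaInf : ℝ))) :
    (∀ i : Fin 2, ∀ t, 0 ≤ t → |RecastData.u postB_SPdamp.angleOf (c t) i.succ| < π) ∧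
    (∀ i : Fin 2, Tendsto (fun t => RecastData.u postB_SPdamp.angleOf (c t) i.succ) atTop (𝓝 0)) ∧
    (∀ j : Fin 3, Tendsto (fun t => (c t).2 j) atTop (𝓝 0)) := by
  -- (1) the tube at T = 1/12
  have htube := faultBus7_tube (T := 1 / 12) (by norm_num) le_rfl hY hω0 ha2 ha3 (1 / 12)
    ⟨by norm_num, le_rfl⟩
  obtain ⟨w0l, w0u, d0l, d0u⟩ := htube 0
  obtain ⟨w1l, w1u, d1l, d1u⟩ := htube 1
  obtain ⟨w2l, w2u, d2l, d2u⟩ := htube 2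
  obtain ⟨ha2l, ha2u⟩ := ha2
  obtain ⟨ha3l, ha3u⟩ := ha3
  simp only [tubeLo, tubeHi, Matrix.cons_val_zero, Matrix.cons_val_one, Matrix.head_cons, Matrix.cons_val_two,
    Matrix.tail_cons] at w0l w0u d0l d0u w1l w1u d1l d1u w2l w2u d2l d2u
  -- (2) the cleared state is in K(1/12), so V ≤ c there
  have hc01 : (c 0).1 = (Y (1 / 12)).1 := by rw [hc0]
  have hc02 : ∀ j, (c 0).2 j + (omegaInf : ℝ) = (Y (1 / 12)).2 j := by
    intro j; rw [hc0]; simp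
  have hV0 : WSCC9.deg4_A_sosgram_Dinst_Vz (WSCC9.deg2_A_SPdampH12_Z postB_SPdamp.angleOf (c 0)) ≤
      1159 / 1000 := by
    refine hKS (c 0) ?_ ?_ ?_
    · rw [hc01]; constructor <;> norm_num at d0l d0u d1l d1u ha2l ha2u ⊢ <;> linarith
    · rw [hc01]; constructor <;> norm_num at d0l d0u d2l d2u ha3l ha3u ⊢ <;> linarith
    · intro j
      rw [hc02]
      fin_cases j
      · show (Y (1 / 12)).2 0 ∈ Icc (tubeLo 0 / 12) (tubeHi 0 / 12)
        simp only [tubeLo, tubeHi, Matrix.cons_val_zero]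
        exact ⟨by norm_num at w0l ⊢; linarith, by norm_num at w0u ⊢; linarith⟩
      · show (Y (1 / 12)).2 1 ∈ Icc (tubeLo 1 / 12) (tubeHi 1 / 12)
        simp only [tubeLo, tubeHi, Matrix.cons_val_one]
        exact ⟨by norm_num at w1l ⊢; linarith, by norm_num at w1u ⊢; linarith⟩
      · show (Y (1 / 12)).2 2 ∈ Icc (tubeLo 2 / 12) (tubeHi 2 / 12)
        simp only [tubeLo, tubeHi, Matrix.cons_val_two, Matrix.tail_cons, Matrix.head_cons]
        exact ⟨by norm_num at w2l ⊢; linarith, by norm_num at w2u ⊢; linarith⟩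
  -- initial window |u_i(0)| < π: |a_i| ≤ 1/2 and θ*_i ∈ [0, π/2)
  have hacute_s : ∀ i : Fin 3, 0 ≤ postB_SPdamp.s i := by decide +kernel
  have hacute_c : ∀ i : Fin 3, 0 < postB_SPdamp.c i := by decide +kernel
  have hθ : ∀ i : Fin 3, 0 ≤ postB_SPdamp.angleOf i ∧ postB_SPdamp.angleOf i < π / 2 := by
    intro i
    have h1 : postB_SPdamp.angleOf i = Real.arccos ((postB_SPdamp.c i : ℚ) : ℝ) := by
      unfold RecastData.angleOf; rw [if_pos (hacute_s i)]
    rw [h1]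
    exact ⟨Real.arccos_nonneg _, by rw [Real.arccos_lt_pi_div_two]; exact_mod_cast hacute_c i⟩
  have h0win : ∀ i : Fin 2, |RecastData.u postB_SPdamp.angleOf (c 0) i.succ| < π := by
    intro i
    have hπ := Real.pi_gt_three
    unfold RecastData.u
    rw [hc01]
    have hθ0 := hθ 0
    fin_cases i
    · have hθ1 := hθ 1
      show |((Y (1 / 12)).1 1 - (Y (1 / 12)).1 0) - (postB_SPdamp.angleOf 1 - postB_SPdamp.angleOf 0)| < π
      rw [abs_lt]; norm_num at d0l d0u d1l d1u ha2l ha2u ⊢; constructor <;> linarith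
    · have hθ2 := hθ 2
      show |((Y (1 / 12)).1 2 - (Y (1 / 12)).1 0) - (postB_SPdamp.angleOf 2 - postB_SPdamp.angleOf 0)| < π
      rw [abs_lt]; norm_num at d0l d0u d2l d2u ha3l ha3u ⊢; constructor <;> linarith
  -- (3) the deg-4 D-instance ROA at γ = c
  have key := WSCC9.deg4_A_sosgram_Dinst_model_roa postB_SPdamp_eqData (γ := 1159 / 1000) (by norm_num)
    (by unfold WSCC9.deg4_A_sosgram_Dinst_level; norm_num) hc hV0 h0win
  exact ⟨key.2.1, key.2.2.1, key.2.2.2⟩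

/-- **«G1cct-WSCC9-LOWER-K» in THRESHOLD form (every clearing instant `t_cl ≤ 1/12 s`), modulo the named
«union box ⊂ S» fact.**  Same composition with the clearing instant `T ∈ [0, 1/12]` free: by the tube
(`faultBus7_tube`, all `lo_i > 0`, `ω(0) = 0`) the state cleared at ANY `T ≤ 1/12` lies in lit-1's UNION box
`a2 ∈ [a2⁰_lo − hi₁/288, a2⁰_hi + hi₂/288]`, `a3 ∈ [a3⁰_lo − hi₁/288, a3⁰_hi + hi₃/288]`, printed speeds
`ω_i ∈ [0, hi_i/12]`; so ONE kernel inequality `hKSU` («`V_deg4 ∘ recast ≤ 1159/1000` on that union box»,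
the «K ⊂ S» owner's rider file — by subdivision if the natural extension is too coarse) gives: for every
`T ∈ [0, 1/12]`, every fault-on solution on `[0, T]` from the printed pre-fault point and every post-fault
solution from the state cleared at `T`: no pole slip, `u_i → 0`, speeds `→ 0`.
[cite: AndersonFouad1977, Example 2.6; Moore1979, §8.1 eq. (8.10)] -/
theorem wscc9_clearing_le_5cycles_returns_of_KSU
    (hKSU : ∀ x : ClassicalSwing.State 3,
      x.1 1 - x.1 0 ∈ Icc (7617 / 25000 - 223 / 250 / 288 : ℝ) (15239 / 50000 + 48009 / 1000 / 288) →
      x.1 2 - x.1 0 ∈ Icc (761 / 4000 - 223 / 250 / 288 : ℝ) (3807 / 20000 + 29611 / 1000 / 288) →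
      (∀ j : Fin 3, x.2 j + (omegaInf : ℝ) ∈ Icc 0 (tubeHi j / 12)) →
      WSCC9.deg4_A_sosgram_Dinst_Vz (WSCC9.deg2_A_SPdampH12_Z postB_SPdamp.angleOf x) ≤ 1159 / 1000)
    {T : ℝ} (hT0 : 0 ≤ T) (hT : T ≤ 1 / 12)
    {Y : ℝ → ClassicalSwing.State 3} (hY : faultBus7Printed.IsSolutionOn Y (Icc 0 T))
    (hω0 : (Y 0).2 = 0) (ha2 : (Y 0).1 1 - (Y 0).1 0 ∈ a2Window) (ha3 : (Y 0).1 2 - (Y 0).1 0 ∈ a3Window)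
    {c : ℝ → ClassicalSwing.State 3} (hc : postB_SPdamp.toModel.IsSolutionOn c (Ici 0))
    (hc0 : c 0 = ((Y T).1, fun j => (Y T).2 j - (omegaInf : ℝ))) :
    (∀ i : Fin 2, ∀ t, 0 ≤ t → |RecastData.u postB_SPdamp.angleOf (c t) i.succ| < π) ∧
    (∀ i : Fin 2, Tendsto (fun t => RecastData.u postB_SPdamp.angleOf (c t) i.succ) atTop (𝓝 0)) ∧
    (∀ j : Fin 3, Tendsto (fun t => (c t).2 j) atTop (𝓝 0)) := by
  -- (1) the tube at the clearing instant T
  have htube := faultBus7_tube hT0 hT hY hω0 ha2 ha3 T ⟨hT0, le_rfl⟩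
  obtain ⟨w0l, w0u, d0l, d0u⟩ := htube 0
  obtain ⟨w1l, w1u, d1l, d1u⟩ := htube 1
  obtain ⟨w2l, w2u, d2l, d2u⟩ := htube 2
  obtain ⟨ha2l, ha2u⟩ := ha2
  obtain ⟨ha3l, ha3u⟩ := ha3
  simp only [tubeLo, tubeHi, Matrix.cons_val_zero, Matrix.cons_val_one, Matrix.head_cons, Matrix.cons_val_two,
    Matrix.tail_cons] at w0l w0u d0l d0u w1l w1u d1l d1u w2l w2u d2l d2u
  have hT2 : T ^ 2 ≤ 1 / 144 := by nlinarith
  have hT2' : 0 ≤ T ^ 2 := sq_nonneg T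
  -- linear envelopes at T ≤ 1/12 (all lo_i > 0)
  have e0l : 0 ≤ (Y T).1 0 - (Y 0).1 0 := le_trans (by positivity) d0l
  have e1l : 0 ≤ (Y T).1 1 - (Y 0).1 1 := le_trans (by positivity) d1l
  have e2l : 0 ≤ (Y T).1 2 - (Y 0).1 2 := le_trans (by positivity) d2l
  have e0u : (Y T).1 0 - (Y 0).1 0 ≤ 223 / 250 / 288 := le_trans d0u (by linarith)
  have e1u : (Y T).1 1 - (Y 0).1 1 ≤ 48009 / 1000 / 288 := le_trans d1u (by linarith)
  have e2u : (Y T).1 2 - (Y 0).1 2 ≤ 29611 / 1000 / 288 := le_trans d2u (by linarith)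
  have v0l : 0 ≤ (Y T).2 0 := le_trans (by positivity) w0l
  have v1l : 0 ≤ (Y T).2 1 := le_trans (by positivity) w1l
  have v2l : 0 ≤ (Y T).2 2 := le_trans (by positivity) w2l
  have v0u : (Y T).2 0 ≤ 223 / 250 / 12 := le_trans w0u (by linarith)
  have v1u : (Y T).2 1 ≤ 48009 / 1000 / 12 := le_trans w1u (by linarith)
  have v2u : (Y T).2 2 ≤ 29611 / 1000 / 12 := le_trans w2u (by linarith)
  -- (2) the cleared state is in the union box, so V ≤ c there
  have hc01 : (c 0).1 = (Y T).1 := by rw [hc0]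
  have hc02 : ∀ j, (c 0).2 j + (omegaInf : ℝ) = (Y T).2 j := by
    intro j; rw [hc0]; simp
  have hV0 : WSCC9.deg4_A_sosgram_Dinst_Vz (WSCC9.deg2_A_SPdampH12_Z postB_SPdamp.angleOf (c 0)) ≤
      1159 / 1000 := by
    refine hKSU (c 0) ?_ ?_ ?_
    · rw [hc01]; constructor <;> norm_num at ha2l ha2u e0u e1u ⊢ <;> linarith
    · rw [hc01]; constructor <;> norm_num at ha3l ha3u e0u e2u ⊢ <;> linarith
    · intro j
      rw [hc02]
      fin_cases j
      · show (Y T).2 0 ∈ Icc 0 (tubeHi 0 / 12)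
        simp only [tubeHi, Matrix.cons_val_zero]; exact ⟨v0l, v0u⟩
      · show (Y T).2 1 ∈ Icc 0 (tubeHi 1 / 12)
        simp only [tubeHi, Matrix.cons_val_one]; exact ⟨v1l, v1u⟩
      · show (Y T).2 2 ∈ Icc 0 (tubeHi 2 / 12)
        simp only [tubeHi, Matrix.cons_val_two, Matrix.tail_cons, Matrix.head_cons]; exact ⟨v2l, v2u⟩
  -- initial window |u_i(0)| < π
  have hacute_s : ∀ i : Fin 3, 0 ≤ postB_SPdamp.s i := by decide +kernel
  have hacute_c : ∀ i : Fin 3, 0 < postB_SPdamp.c i := by decide +kernel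
  have hθ : ∀ i : Fin 3, 0 ≤ postB_SPdamp.angleOf i ∧ postB_SPdamp.angleOf i < π / 2 := by
    intro i
    have h1 : postB_SPdamp.angleOf i = Real.arccos ((postB_SPdamp.c i : ℚ) : ℝ) := by
      unfold RecastData.angleOf; rw [if_pos (hacute_s i)]
    rw [h1]
    exact ⟨Real.arccos_nonneg _, by rw [Real.arccos_lt_pi_div_two]; exact_mod_cast hacute_c i⟩
  have h0win : ∀ i : Fin 2, |RecastData.u postB_SPdamp.angleOf (c 0) i.succ| < π := by
    intro i
    have hπ := Real.pi_gt_three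
    unfold RecastData.u
    rw [hc01]
    have hθ0 := hθ 0
    fin_cases i
    · have hθ1 := hθ 1
      show |((Y T).1 1 - (Y T).1 0) - (postB_SPdamp.angleOf 1 - postB_SPdamp.angleOf 0)| < π
      rw [abs_lt]; norm_num at ha2l ha2u e0u e1u ⊢; constructor <;> linarith
    · have hθ2 := hθ 2
      show |((Y T).1 2 - (Y T).1 0) - (postB_SPdamp.angleOf 2 - postB_SPdamp.angleOf 0)| < π
      rw [abs_lt]; norm_num at ha3l ha3u e0u e2u ⊢; constructor <;> linarith
  -- (3) the deg-4 D-instance ROA at γ = c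
  have key := WSCC9.deg4_A_sosgram_Dinst_model_roa postB_SPdamp_eqData (γ := 1159 / 1000) (by norm_num)
    (by unfold WSCC9.deg4_A_sosgram_Dinst_level; norm_num) hc hV0 h0win
  exact ⟨key.2.1, key.2.2.1, key.2.2.2⟩

end Summit.Ventures.GridStability.Bench

end
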